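import Summits.FinalStateConjecture.FinalStateConjecture.Theses.ZeroEnergyKerrOrBomb
import Summits.FinalStateConjecture.FinalStateConjecture.Theorems.ZeroEnergyKerrOrBombZeroEnergyRigidityStubKerrChartTransfer
import Summits.FinalStateConjecture.FinalStateConjecture.Theorems.ZeroEnergyKerrOrBombZeroEnergyRigidityStubNonRotatingUniqueness
import Summits.FinalStateConjecture.FinalStateConjecture.Theorems.ZeroEnergyKerrOrBombZeroEnergyRigidityStubRotatingUniqueness
import Literature.Geometry.Lorentzian.LorentzianMetricProofs
import Literature.Geometry.Lorentzian.CausalityOpennessProofs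

/-!
# `ZeroEnergyRigidity`, line `global-horizon-killing-field` — the regular case, modulo four published theorems

Crux `stmt-FinalStateConjecture-10690` (`Theses.ZeroEnergyKerrOrBomb.ZeroEnergyRigidity`).  This file
assembles the landed stubs S2c (`NonRotatingUniqueness.stub_nonRotatingUniqueness_of`), S3c
(`RotatingUniqueness.stub_rotatingUniqueness_of`) and S4 (`KerrChartTransfer.stub_kerrChartTransfer`)
of the lead's skeleton into the line's CLASSICAL HALF, as one sorry-free theorem
(`stub_kerrConclusion_of_regular`, registered on the crux item):

> the four published theorems `SudarskyWald1993_staticity`, `ChruscielGalloway2010_docStaticUniqueness`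
> (Literature `NonRotatingBlackHoleUniqueness.lean`), `ChruscielCostaHeusler2012_axisymmetricUniqueness`
> (`AxisymmetricBlackHoleUniqueness.lean`) and `BeigChrusciel1997_axisymmetricCombination`
> (`KillingAlgebraAsymptoticallyFlat.lean`) imply: every vacuum, `I⁺`-REGULAR stationary
> asymptotically flat black-hole presentation `𝓑` with connected future event horizon which carries a
> Killing field `K` on the whole carrier that is complete, commutes with the stationary field `T`,
> is nowhere zero on and tangent to `𝓔⁺` and satisfies `∇_K K = κ K` there with one constant
> `κ ≠ 0`, has its domain of outer communications equal to the image of an injective smooth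
> isometric immersion of a sub-extremal Kerr exterior `(Kerr.exterior M a, g_{M,a})`, `|a| < M`.

This is the conclusion of the crux, verbatim, for the presentations the crux's remaining stub S1
(`stub_regularRepresentation`) produces; the crux itself is this theorem precomposed with S1 and
post-composed with the d.o.c. transport S5 (`DocIsometryTransfer.stub_docIsometryTransfer`), see the
registered skeleton `Cruxes/ZeroEnergyRigidity/Lines/global-horizon-killing-field.lean`.

Proof: the dichotomy of Chruściel–Costa–Heusler 2012, §3: either `K = c • T` (`c ≠ 0` because `K ≠ 0`
on the non-empty horizon) — the hole is non-rotating and S2c applies (Sudarsky–Wald staticity, then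
static uniqueness: Schwarzschild, `a = 0`) — or `K ∉ ℝT` — two independent Killing fields, S3c applies
(Beig–Chruściel axisymmetric combination, then CCH12 Thm. 3.2: Kerr).  Either branch yields the
vendored `IsIsometricToKerrExterior` at the discharged prelude facts, which S4 converts to the chart form.

References: P. T. Chruściel, J. L. Costa, M. Heusler, Living Rev. Relativity 15 (2012) 7, §3
(Thms. 3.1–3.3, §§3.2.1, 3.3.1); P. T. Chruściel, J. L. Costa, arXiv:0806.0016, Thm. 1.3 and §7.2.
-/

noncomputable section

-- summit = problem name (D-0017)
set_option linter.dupNamespace false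

namespace Summit.FinalStateConjecture.FinalStateConjecture.Theorems.ZeroEnergyRigidity.GlobalHorizonKillingField.RegularCase

open Set Function Literature.Geometry.Lorentzian
open scoped Manifold ContDiff Topology

section Prelude

variable (𝓑 : StationaryAFBlackHole.{0})

/-- `I⁺(S)` is open on the (boundaryless) carrier: the prelude fact `hF` of the uniqueness schema,
discharged (O'Neill 1983, Lemma 14.3, proved in the tree). -/
theorem hF_holds : 𝓑.metric.isOpen_chronologicalFuture 𝓑.timeOrientation :=
  LorentzianMetric.isOpen_chronologicalFuture_holds_of_boundaryless

/-- `I⁻(S)` is open on the (boundaryless) carrier: the prelude fact `hP`, discharged. -/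
theorem hP_holds : 𝓑.metric.isOpen_chronologicalPast 𝓑.timeOrientation :=
  LorentzianMetric.isOpen_chronologicalPast_holds_of_boundaryless

/-- Restrictions of smooth bilinear sections to open sets are smooth: the prelude fact `hres`,
discharged. -/
theorem hres_holds :
    PseudoRiemannianMetric.contMDiff_restrict (I := 𝓡 4) (n := (∞ : ℕ∞ω)) (M := 𝓑.carrier) :=
  PseudoRiemannianMetric.contMDiff_restrict_holds

end Prelude

/-- A vector field of the form `c • T` vanishing nowhere on a non-empty set has `c ≠ 0`. -/
theorem ne_zero_of_smul_ne_zero {𝓑 : StationaryAFBlackHole.{0}} {c : ℝ}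
    (hne : ∀ p ∈ 𝓑.horizon, (c • 𝓑.killing) p ≠ 0) (hH : 𝓑.horizon.Nonempty) : c ≠ 0 := by
  rintro rfl
  obtain ⟨p, hp⟩ := hH
  exact hne p hp (by simp)

/-- **Registered stub `stub_kerrConclusion_of_regular` — the classical half of the line.**  Modulo
the four published theorems (hypotheses `h₁`–`h₄`, Literature named facts), every vacuum
`I⁺`-regular presentation with connected horizon and a complete, `T`-commuting, horizon-generating
Killing field with `κ ≠ 0` has d.o.c. isometric (as the image of an injective isometric immersion)
to a sub-extremal Kerr exterior.  Chruściel–Costa–Heusler 2012, §3 (dichotomy non-rotating /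
rotating; Thm. 3.1 via Sudarsky–Wald, Thm. 3.2 via Beig–Chruściel). -/
theorem stub_kerrConclusion_of_regular :
    SudarskyWald1993_staticity → ChruscielGalloway2010_docStaticUniqueness →
    ChruscielCostaHeusler2012_axisymmetricUniqueness.{0} →
    BeigChrusciel1997_axisymmetricCombination.{0} →
    ∀ (𝓑 : StationaryAFBlackHole.{0}) [𝓑.metric.HasLeviCivita] [Kerr.Facts],
      𝓑.metric.toPseudoRiemannianMetric.IsRicciFlat → 𝓑.IsIPlusRegular → IsConnected 𝓑.horizon →
      (∃ K : Π x : 𝓑.carrier, TangentSpace (𝓡 4) x,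
        𝓑.metric.IsKillingField K ∧ IsCompleteVectorField K ∧
        (∀ x, VectorField.mlieBracket (𝓡 4) 𝓑.killing K x = 0) ∧
        (∀ p ∈ 𝓑.horizon, K p ≠ 0) ∧
        (∀ γ : ℝ → 𝓑.carrier, IsMIntegralCurve γ K → γ 0 ∈ 𝓑.horizon → ∀ t, γ t ∈ 𝓑.horizon) ∧
        ∃ κ : ℝ, κ ≠ 0 ∧ ∀ p ∈ 𝓑.horizon, 𝓑.metric.leviCivita K p (K p) = κ • K p) →
      ∃ (M a : ℝ), Kerr.IsSubextremal M a ∧ ∃ Ψ : Kerr.exterior M a → 𝓑.carrier,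
        Function.Injective Ψ ∧ Set.range Ψ = 𝓑.doc ∧
          PseudoRiemannianMetric.IsIsometricImmersion
            (Kerr.smoothMetric M a (Kerr.rPlus M a)).toPseudoRiemannianMetric
            𝓑.metric.toPseudoRiemannianMetric Ψ := by
  intro h₁ h₂ h₃ h₄ 𝓑 _ _ hvac hreg hconn hK
  obtain ⟨K, hK, hKc, hcomm, hne, htan, hκ⟩ := hK
  classical
  by_cases hrot : ∃ c : ℝ, K = c • 𝓑.killing
  · -- non-rotating branch: `K = c • T`, `c ≠ 0`
    obtain ⟨c, rfl⟩ := hrot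
    have hc : c ≠ 0 := ne_zero_of_smul_ne_zero hne hconn.nonempty
    exact KerrChartTransfer.stub_kerrChartTransfer 𝓑
      (NonRotatingUniqueness.stub_nonRotatingUniqueness_of h₁ h₂ 𝓑 (hF_holds 𝓑) (hP_holds 𝓑)
        (hres_holds 𝓑)
        ⟨⟨hreg, hconn, fun {_} ↦ ⟨c • 𝓑.killing, hK, hne, htan, hκ⟩⟩,
          fun {_} ↦ ⟨c, hc, hK, hne, htan, hκ⟩⟩ hvac)
  · -- rotating branch: `T` and `K` independent Killing fields
    exact KerrChartTransfer.stub_kerrChartTransfer 𝓑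
      (RotatingUniqueness.stub_rotatingUniqueness_of h₃ h₄ 𝓑 (hF_holds 𝓑) (hP_holds 𝓑)
        (hres_holds 𝓑) ⟨hreg, hconn, fun {_} ↦ ⟨K, hK, hKc, hcomm, hne, htan, hκ, hrot⟩⟩ hvac)

end Summit.FinalStateConjecture.FinalStateConjecture.Theorems.ZeroEnergyRigidity.GlobalHorizonKillingField.RegularCase

end
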